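import Summits.QuantumFields.YangMills.Theses.RenyiTelescope
import Summits.QuantumFields.YangMills.Theorems.SmallFieldWideningLargeFieldMassRefinementTailOfTailRoutes

/-!
# Route `RenyiTelescope` — glue item `HistoryTailOfRenyiTelescope` (stmt-QuantumFields-27139): K2-L `HistoryTailL` FROM A UNIT-EVENT TAIL OF THE
# REFINED FAMILIES (support file; ideator seat `ym-r3-idea-2` g3, registered stub `stub_unitEventReduction` of the glue skeleton)

THE STEP (G1 + G5 of the glue plan attached to the item; §6 "the c·b₀ profile trick").  Crux K2-L `HistoryTailL` lets the glue CHOOSE the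
profile constant `b₀`: it is enough to prove `HistoryTailAt F γ (c·b₀) p₀ m` for the `c`-SCALED profile (`c(L) ∈ (0, 1]` the interior-window
constant of crux `CutoffRenyiL`), with `c·b₀ ≥ b₁`.  At that profile the landed reduction
`HistoryTailOfTwoSided.historyTailAt_of_bare_finestBad` (route `FibreConvexityTail`) asks for a bare profile — the tree's `T3BareTailProfile.bareTailAt`
— and a finest-bad-level profile `q(d)` bounding, for every run `K = J + d` and every level `1 ≤ J`, height `d ≥ 2`, the piece
`{¬PlaqSmall θ_c(d) (Ū^J)} ∩ {∀ i < J, PlaqSmall θ_c(J+d−i) (Ū^i)}`.  By the PLAQUETTE-EVENT TRANSPORT (registered stub `stub_plaquetteTransport`,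
proved in `Theorems/RenyiTelescopePlaquetteTransport.lean`; taken here as a HYPOTHESIS so that this file does not depend on that one) each piece is
bounded by the sum over the unit plaquettes `p` of `F.refine d` of the Gibbs masses (run `J`, coupling `γL^(-d)`) of
`(unitA)⁻¹{θ'_c(0) ≤ |V(∂p) − 1|} ∩ histGoodInt (F.refine d) θ'_(b₀) (θ'_c 1) J 1` — the events of the cruxes.  HENCE (`stub_unitEventReduction`):
if those unit events have, for each admissible `(F, γ)`, a tail `≤ C·exp(−a·p(g_d)²)` for all depths `d ≥ h₀(F,γ)`, all cut-offs `J ≥ 1` and all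
`p` (the "UNIT-EVENT TAIL" schema — exactly what the Rényi telescope of the line is to deliver from `CutoffRenyiL` + `FineRegimeUnitTailL`), then
`HistoryTailL` holds: the plaquette count `≤ 9·8·L^(3m)·L^(3d)` (`card_plaq_le_pow`, `plaqShift`) and the tree arithmetic
`T3AveragedTailProfile.perHeight_bound` (`exists_perHeight_bound`, exponent `A = 0`) make the profile geometric, `q(d) = (A' + 2^h₀)·2^(−d)` — the
summand `2^h₀·2^(−d) ≥ 1` covers the finitely many depths `d < h₀` where only the trivial bound `≤ 1` is available (`geometric_profile` gives the
three summabilities).  Choices: `b₀ := max(b₁ᵁ, b₁/c, 1)`, `p₀ := max(p₁ᵁ, p₁, 3)`, `γ₁ := γ₁ᵁ(b₀, p₀) ≤ 1` (independent of `m`).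

WHAT THIS IS NOT: no estimate of any Gibbs probability is proved here — the unit-event tail is the HYPOTHESIS (it is the named remainder
`stub_glueRest` of the glue skeleton: cruxes 27137 + 27138 + the conditional telescope ⇒ the schema); the cruxes are untouched; nothing here bears
on the Yang–Mills mass gap, and the rung R3 (`YM3TorusSU2`) is NOT proved.

References: T. Bałaban, CMP 102 (1985) 255–275 [Balaban1985UV3] ((7) p.257: decomposition of unity by the first large scale; (71) p.273: the
per-plaquette large-field factors); J. Fröhlich, R. Israel, E. Lieb, B. Simon, CMP 62 (1978) 1–34 [FrohlichIsraelLiebSimon1978] (chessboard estimate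
behind the bare term `bareTailAt`).
-/

noncomputable section

open MeasureTheory
open Literature.MathematicalPhysics.QuantumFieldTheory.Balaban1983to89
open Literature.MathematicalPhysics.QuantumFieldTheory.Balaban1983to89.T3ContinuumYM3Torus
open Literature.MathematicalPhysics.QuantumFieldTheory.Balaban1983to89.T3UnitScaleTilt
open Literature.MathematicalPhysics.QuantumFieldTheory.Balaban1983to89.T3UnitLawDensityEML
open Literature.MathematicalPhysics.QuantumFieldTheory.Balaban1983to89.T3InteriorExcision
open Literature.MathematicalPhysics.QuantumFieldTheory.Balaban1983to89.T3LevelShift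
open Literature.MathematicalPhysics.QuantumFieldTheory.Balaban1983to89.T3BareTailProfile
open Summit.QuantumFields.YangMills.Theorems.HistoryTailOfTwoSided

namespace Summit.QuantumFields.YangMills.Theorems.RenyiTelescope

/-! ## §1 Arithmetic -/

/-- `1 ≤ 2^h₀ · (1/2)^d` for `d ≤ h₀`. [folklore] -/
theorem one_le_two_pow_mul_half_pow {h₀ d : ℕ} (h : d ≤ h₀) : (1 : ℝ) ≤ (2 : ℝ) ^ h₀ * ((1 : ℝ) / 2) ^ d := by
  obtain ⟨k, rfl⟩ : ∃ k, h₀ = d + k := ⟨h₀ - d, by omega⟩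
  have h2 : (2 : ℝ) ^ d * ((1 : ℝ) / 2) ^ d = 1 := by
    rw [← mul_pow]
    norm_num
  calc (1 : ℝ) ≤ (2 : ℝ) ^ k := one_le_pow₀ (by norm_num)
    _ = (2 : ℝ) ^ k * ((2 : ℝ) ^ d * ((1 : ℝ) / 2) ^ d) := by rw [h2, mul_one]
    _ = (2 : ℝ) ^ (d + k) * ((1 : ℝ) / 2) ^ d := by rw [pow_add]; ring

/-- The unit plaquettes of `F.refine d` are as many as the level-`J` plaquettes of run `J + d` of `F`: at most `9·8·L^(3m)·(L^d)³`.
[cite: Balaban1985UV3, (1)-(3) p.256] -/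
theorem card_unitPlaq_refine_le (F : T3Family) (d J : ℕ) :
    (Fintype.card (Plaq ((F.refine d).P 0) 0) : ℝ) ≤ 9 * (8 * (F.L : ℝ) ^ (3 * F.m) * ((F.L : ℝ) ^ d) ^ 3) := by
  have h1 : Fintype.card (Plaq ((F.refine d).P 0) 0) = Fintype.card (Plaq (F.P (J + d)) J) :=
    (Fintype.card_congr (plaqShift (F.sitesPerDir_eq (m := F.m) (K := J + d) (j := J) (m' := F.m + d) (K' := 0) (j' := 0)
      (by omega)) : Plaq (F.P (J + d)) J ≃ Plaq ((F.refine d).P 0) 0)).symm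
  have h2 := card_plaq_le_pow F (K := J + d) (j := J) (by omega)
  rw [Nat.add_sub_cancel_left] at h2
  rw [h1]
  exact h2

/-! ## §2 The registered stub -/

/-- **REGISTERED STUB `stub_unitEventReduction` OF THE GLUE SKELETON (item stmt-QuantumFields-27139)**: the plaquette-event transport AND a
unit-event tail `≤ C e^(−a p(g_d)²)` of the refined families (depths `d ≥ h₀(F,γ)`, cut-offs `J ≥ 1`, every unit plaquette; constants `c, b₁, p₁`
after `L`, `γ₁ ≤ 1` after the profile, `h₀, C, a` after `(F, γ)`) imply crux K2-L `HistoryTailL` — at the profile `(c·b₀, p₀)`, via the landed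
`historyTailAt_of_bare_finestBad` with the bare profile `bareTailAt` and the geometric finest-bad-level profile `(A' + 2^h₀)·2^(−d)`.
[cite: Balaban1985UV3, (7) p.257 and (71) p.273] -/
theorem stub_unitEventReduction :
    (∀ (F : T3Family) (γ b₀ c p₀ : ℝ) (d J : ℕ), 0 < γ → γ ≤ 1 → 0 < b₀ → c ≤ 1 → 1 ≤ J →
    (gibbsK F ℰp γ (J + d)).real
        ({U | ¬ PlaqSmall (θBal F.L γ (c * b₀) p₀ (J + d - J))
            (Averaging.iter (fun i => BlockAveraging.blockAvg (P := F.P (J + d)) (j := i) ℰp) J U)} ∩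
          {U | ∀ i, i < J → PlaqSmall (θBal F.L γ (c * b₀) p₀ (J + d - i))
            (Averaging.iter (fun i' => BlockAveraging.blockAvg (P := F.P (J + d)) (j := i') ℰp) i U)}) ≤
      ∑ p : Plaq ((F.refine d).P 0) 0,
        (gibbsK (F.refine d) ℰp (γ * ((F.L : ℝ)⁻¹) ^ d) J).real
          ((unitA (F.refine d) ℰp J) ⁻¹'
              {V | θBal F.L (γ * ((F.L : ℝ)⁻¹) ^ d) (c * b₀) p₀ 0 ≤ GaugeGroup.dist1 (GaugeField.plaqHol V p)} ∩
            histGoodInt (F.refine d) (θBal F.L (γ * ((F.L : ℝ)⁻¹) ^ d) b₀ p₀)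
              (θBal F.L (γ * ((F.L : ℝ)⁻¹) ^ d) (c * b₀) p₀ 1) J 1)) →
    (∀ (L : ℕ), ∃ (c b₁ p₁ : ℝ), 0 < c ∧ c ≤ 1 ∧ ∀ (b₀ p₀ : ℝ), b₁ ≤ b₀ → p₁ ≤ p₀ → 0 < b₀ → 2 < p₀ →
      ∃ γ₁ : ℝ, 0 < γ₁ ∧ γ₁ ≤ 1 ∧ ∀ (F : T3Family) (γ : ℝ), F.L = L → 0 < γ → γ ≤ γ₁ →
        ∃ (h₀ : ℕ) (C a : ℝ), 0 ≤ C ∧ 0 < a ∧ ∀ (d J : ℕ) (p : Plaq ((F.refine d).P 0) 0), h₀ ≤ d → 1 ≤ J →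
          (gibbsK (F.refine d) ℰp (γ * ((F.L : ℝ)⁻¹) ^ d) J).real
              ((unitA (F.refine d) ℰp J) ⁻¹'
                  {V | θBal F.L (γ * ((F.L : ℝ)⁻¹) ^ d) (c * b₀) p₀ 0 ≤ GaugeGroup.dist1 (GaugeField.plaqHol V p)} ∩
                histGoodInt (F.refine d) (θBal F.L (γ * ((F.L : ℝ)⁻¹) ^ d) b₀ p₀)
                  (θBal F.L (γ * ((F.L : ℝ)⁻¹) ^ d) (c * b₀) p₀ 1) J 1) ≤
            C * Real.exp (-(a * (B10.pFun b₀ p₀ (Real.sqrt (γ * ((F.L : ℝ)⁻¹) ^ d))) ^ 2))) →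
    Summit.QuantumFields.YangMills.Theses.UnitScaleTilt.HistoryTailL := by
  intro hP hU L b₁ p₁
  obtain ⟨c, b₁', p₁', hc, hc1, hU1⟩ := hU L
  -- the profile: `b₀ ≥ b₁ᵁ, b₁/c, 1`, `p₀ ≥ p₁ᵁ, p₁, 3`
  obtain ⟨b₀, hb₀1, hb₀c, hb₀pos⟩ : ∃ b₀ : ℝ, b₁' ≤ b₀ ∧ b₁ / c ≤ b₀ ∧ 0 < b₀ :=
    ⟨max (max b₁' (b₁ / c)) 1, (le_max_left _ _).trans (le_max_left _ _), (le_max_right _ _).trans (le_max_left _ _),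
      lt_of_lt_of_le one_pos (le_max_right _ _)⟩
  obtain ⟨p₀, hp₀1, hp₀2, hp₀3⟩ : ∃ p₀ : ℝ, p₁' ≤ p₀ ∧ p₁ ≤ p₀ ∧ 3 ≤ p₀ :=
    ⟨max (max p₁' p₁) 3, (le_max_left _ _).trans (le_max_left _ _), (le_max_right _ _).trans (le_max_left _ _),
      le_max_right _ _⟩
  have hp₀gt : 2 < p₀ := by linarith
  have hp₀one : 1 ≤ p₀ := by linarith
  obtain ⟨γ₁, hγ₁, hγ₁1, hU2⟩ := hU1 b₀ p₀ hb₀1 hp₀1 hb₀pos hp₀gt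
  have hb₁ : b₁ ≤ c * b₀ :=
    calc b₁ ≤ b₀ * c := (div_le_iff₀ hc).mp hb₀c
      _ = c * b₀ := mul_comm _ _
  refine ⟨c * b₀, p₀, hb₁, hp₀2, mul_pos hc hb₀pos, hp₀gt, fun m hm => ⟨γ₁, hγ₁, fun F γ hFL hγ hγle => ?_⟩⟩
  -- one family `F` with `F.L = L` at `0 < γ ≤ γ₁ ≤ 1`
  have hγ1 : γ ≤ 1 := hγle.trans hγ₁1
  obtain ⟨h₀, C, a, hC, ha, hb⟩ := hU2 F γ hFL hγ hγle
  obtain ⟨q₀, hq₀0, hq₀, -, hbare⟩ := bareTailAt F hγ hγ1 (mul_pos hc hb₀pos) hp₀one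
  obtain ⟨A', hA'0, hPH⟩ := exists_perHeight_bound F hγ hγ1 hb₀pos hp₀one hC 0 ha
  have hA0 : 0 ≤ A' + (2 : ℝ) ^ h₀ := by positivity
  obtain ⟨hq0, hq, hqt⟩ := geometric_profile hA0
  refine historyTailAt_of_bare_finestBad F hγ.le (c * b₀) p₀ hm q₀ (fun i => (A' + (2 : ℝ) ^ h₀) * ((1 : ℝ) / 2) ^ i)
    hq₀0 hq₀ hq0 hq hqt hbare fun K j hj hjK => ?_
  -- one height: `K = j + d`, `d ≥ 2`, `j ≥ 1`
  obtain ⟨d, rfl⟩ : ∃ d, K = j + d := ⟨K - j, by omega⟩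
  have hPiece := hP F γ b₀ c p₀ d j hγ hγ1 hb₀pos hc1 hj
  show _ ≤ (A' + (2 : ℝ) ^ h₀) * ((1 : ℝ) / 2) ^ (j + d - j)
  rw [Nat.add_sub_cancel_left] at hPiece ⊢
  haveI := isProbabilityMeasure_gibbsK F ℰp hγ.le (j + d)
  have hhalf : 0 ≤ ((1 : ℝ) / 2) ^ d := by positivity
  by_cases hd : h₀ ≤ d
  · -- transported, bounded per unit plaquette, counted, made geometric
    refine hPiece.trans ((Finset.sum_le_sum fun p _ => hb d j p hd hj).trans ?_)
    rw [Finset.sum_const, Finset.card_univ, nsmul_eq_mul]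
    have hX : 0 ≤ C * Real.exp (-(a * (B10.pFun b₀ p₀ (Real.sqrt (γ * ((F.L : ℝ)⁻¹) ^ d))) ^ 2)) :=
      mul_nonneg hC (Real.exp_nonneg _)
    have hP' := hPH d
    rw [pow_zero, mul_one] at hP'
    calc (Fintype.card (Plaq ((F.refine d).P 0) 0) : ℝ) *
          (C * Real.exp (-(a * (B10.pFun b₀ p₀ (Real.sqrt (γ * ((F.L : ℝ)⁻¹) ^ d))) ^ 2)))
        ≤ 9 * (8 * (F.L : ℝ) ^ (3 * F.m) * ((F.L : ℝ) ^ d) ^ 3) *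
          (C * Real.exp (-(a * (B10.pFun b₀ p₀ (Real.sqrt (γ * ((F.L : ℝ)⁻¹) ^ d))) ^ 2))) :=
          mul_le_mul_of_nonneg_right (card_unitPlaq_refine_le F d j) hX
      _ ≤ A' * ((1 : ℝ) / 2) ^ d := hP'
      _ ≤ (A' + (2 : ℝ) ^ h₀) * ((1 : ℝ) / 2) ^ d :=
          mul_le_mul_of_nonneg_right (le_add_of_nonneg_right (by positivity)) hhalf
  · -- `d < h₀`: the trivial bound
    calc _ ≤ (1 : ℝ) := measureReal_le_one
      _ ≤ (2 : ℝ) ^ h₀ * ((1 : ℝ) / 2) ^ d := one_le_two_pow_mul_half_pow (by omega)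
      _ ≤ (A' + (2 : ℝ) ^ h₀) * ((1 : ℝ) / 2) ^ d := mul_le_mul_of_nonneg_right (le_add_of_nonneg_left hA'0) hhalf

end Summit.QuantumFields.YangMills.Theorems.RenyiTelescope

end
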